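import Literature.Barriers.CriticalPhenomena.PlaquetteWalkHoleRootSectorDirections
import Literature.Barriers.CriticalPhenomena.PlaquetteWalkWoundMassBound
import HarnessLib

/-!
# Barrier catalogue (SAWScalingLimit): the UNIVERSAL DIRECTION TABLE of the Yang–Baxter class terms at an ARBITRARY
cell of a hole root — one explicit unit `dir₀(θ; z₀, z₁, z₂)` per pattern, times an eighth root of unity per sector

Composition of two catalogue entries. The SECTOR FORM (`PlaquetteWalkHoleRootSectorDirections`:
`ΩG.classTerm_sector_form`) says that for a hole root in the `W`-normalisation (root = the `W` side of `w`, the plaquette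
`(w.1 − 1, w.2)` across it not in the domain) every WOUND class-`B2a` walk at ANY rooted plaquette `r` with non-empty
prefix has `classTerm(θ) = ext(θ)·[phase(τ(z₀))·ε(z₀;z₁,z₂)·backBracket(θ; z₀,z₁,z₂,z₃)]·phase(2πk)` with
`τ(z₀) = headIn z₀ + (θ − π/2)·𝟙[z₀ slanted]` and an integer sector `k`; the topic's twelve `backBracket` closed forms
(`YangBaxterSAWUnwoundPlaquette`) and the chord signs `ε` then make the bracket EXPLICIT:

* ★ `dirZero` — the table `dir₀(θ; z₀, z₁, z₂)` (24 ordered patterns, symmetric in exit/return): for first side `W`: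
  `{S,N} ↦ e^{−iπ/2}`, `{E,N} ↦ e^{i(3θ/8 − 5π/8)}`, `{E,S} ↦ e^{i(3θ/8 − 3π/4)}`; for `E`: `{S,W} ↦ e^{i(3θ/8 − π/4)}`,
  `{N,W} ↦ e^{i(3θ/8 − 3π/8)}`, `{N,S} ↦ e^{−iπ/8}`; for `S`: `{W,N} ↦ e^{−iπ/4}`, `{E,N} ↦ e^{−i3π/8}`,
  `{W,E} ↦ e^{i(3θ/8 − π/2)}`; for `N`: `{W,S} ↦ e^{−i3π/4}`, `{E,S} ↦ e^{−i5π/8}`, `{E,W} ↦ e^{i(3θ/8 − 7π/8)}` — six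
  CONSTANT sixteenth roots of unity and six rotating as `e^{i·3θ/8}` times a sixteenth root of unity;
* ★★ `dir_term_universal` — `phase(τ(z₀))·ε(z₀;z₁,z₂)·backBracket(θ; z₀,z₁,z₂,z₃) = v(θ)·dir₀(θ; z₀,z₁,z₂)` for every
  admissible pattern (`z₀, z₁, z₂, z₃` pairwise distinct), `norm_dirZero` (`|dir₀| = 1`);
* ★★★ `ΩG.classTerm_universal_form` — for every WOUND class-`B2a` walk at every cell of a `W`-normalised hole root
  (non-empty prefix): `classTerm(θ) = v(θ)·ext(θ)·dir₀(θ; z₀,z₁,z₂)·phase(2πk)` for an integer `k`, with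
  `phase(2πk) = ζ^k`, `ζ = e^{−i5π/4}` (`phase_two_pi_mul_int`); `ΩG.classTerm_zero_or_universal` (the dichotomy)
  — the modulus `‖classTerm‖ = v(θ)·ext(θ)` of a wound term is the catalogue's `PlaquetteWalkWoundMassSplit`; this file
  fixes its DIRECTION up to the sector;
* ★★ `dirZero_mem_alphabet` / ★★★ `ΩG.classTerm_mem_alphabet` — THE DIRECTION ALPHABET: on admissible patterns `dir₀` is a
  constant sixteenth root of unity `e^{iπm/8}` or a rotating one `e^{i(3θ/8 + πm/8)}`, hence every wound class term at every
  cell is `v(θ)·ext(θ)·e^{iπj/8}` or `v(θ)·ext(θ)·e^{i(3θ/8 + πj/8)}` for an integer `j` — sixteen constant and sixteen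
  rotating directions are the complete alphabet of the vertex defect's summands;
* ★★★★ (edition 3) THE UNIVERSAL CELL LAW `PlaquetteWalk.vertexFunctional_printed_cell_eq_universal`: at EVERY cell `c` of a
  `W`-normalised hole root not containing the root, for `θ ∈ [π/3, 2π/3]`,
  `VF_D(w.side W, c) = i·v(θ)·Σ_{ω ∈ B2a(c)} woundMassAt(ω)·dirAt(ω)·phase(2π·sectorOf(ω))` — wound mass (the catalogue's
  `ΩG.woundMassAt`) times a table direction times an eighth root of unity, summed over the class-`B2a` walks (tool notions
  `ΩG.dirAt` = `dir₀` of the walk's pattern, `ΩG.sectorOf` = its sector, junk `0` off the wound class); whence ★★★ THE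
  UNIVERSAL CONE LAW `…_cell_ne_zero_of_cone` (if some rotation `ρ` puts every wound walk's direction
  `dirAt·phase(2π·sectorOf)` in the open right half-plane and one wound walk exists, then `VF ≠ 0`, `θ ∈ (π/3, 2π/3)`) — the
  common form of the ring's eight cone laws and of the far/lateral «one side only» laws, now at any cell — and ★★★ THE
  ALIGNED LAW `…_cell_eq_of_aligned` / `…_cell_ne_zero_of_aligned` (all wound walks sharing ONE direction `u`:
  `VF = i·v(θ)·u·Σ woundMassAt`, non-zero iff a wound walk exists);
* faces against the landed per-cell tables of the ring (`PlaquetteWalkHoleRootRingLaws`, via `SectorDirections`' parents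
  only by value): `dirZero_W_E_S_mul_phase_two_pi` (`dir₀·ζ = e^{i·3θ/8}`, the `LS` direction of a `W`-first walk, sector
  `k = 1`), `dirZero_E_S_W_mul_phase_neg_two_pi` (`dir₀·ζ⁻¹ = e^{i(3θ/8 + π)}`, the `LS` direction of an `E`-first walk,
  sector `k = −1`), `dirZero_N_E_S` / `dirZero_S_W_N` (the `SE` and `NE` cells' `N`-first and `S`-first directions at sector `0`).

So at every cell of every `W`-normalised hole-root domain the vertex defect is `i·v(θ)` times a sum, over the wound
class-`B2a` walks, of `ext·dir₀(pattern)·ζ^{sector}`: sixteen possible directions for the constant patterns and sixteen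
rotating ones — the lane's per-cell «direction tables» (#400, #401, RING LAWS) are the sector-pinned instances, and the
sector census beyond the ring (HOME `FINDING-YB-SECOND-RING-SECTORS`, b-step0 gen 20) is a statement about `k` alone.
Elementary given the parents (venture lane «pcv-sawmu», b-step0 gen 21). References: A. Glazman, I. Manolescu,
arXiv:1708.00395v3, §2.1 and Lemma 2.1 [GlazmanManolescu2019]; A. Glazman, Electron. Commun. Probab. 20 (2015) no. 86,
Lemma 3.1 and eq. (1) [Glazman2015WeightedSAW].
-/

noncomputable section

namespace Literature.Probability.RandomPlanarGeometry.SAW.YangBaxter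

open Real Complex

/-! ## Phase helpers (private twins of the ring files' helpers) -/

section HelpersU

/-- Two phases multiply by adding the angles. [folklore] -/
private theorem cexp_mul_cexpU (a b : ℝ) :
    Complex.exp (((a : ℝ) : ℂ) * Complex.I) * Complex.exp (((b : ℝ) : ℂ) * Complex.I) =
      Complex.exp ((((a + b : ℝ)) : ℂ) * Complex.I) := by
  rw [← Complex.exp_add]; congr 1; push_cast; ring

/-- A phase times `e^{iθ}` (the bare-`θ` closed forms). [folklore] -/
private theorem cexp_mul_cexp_thetaU (a θ : ℝ) :
    Complex.exp (((a : ℝ) : ℂ) * Complex.I) * Complex.exp ((θ : ℂ) * Complex.I) =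
      Complex.exp ((((a + θ : ℝ)) : ℂ) * Complex.I) := by
  rw [← Complex.exp_add]; congr 1; push_cast; ring

/-- Angles differing by a multiple of `2π` give the same phase. [folklore] -/
private theorem cexp_I_eq_of_intU (a b : ℝ) (n : ℤ) (h : a = b + n * (2 * π)) :
    Complex.exp (((a : ℝ) : ℂ) * Complex.I) = Complex.exp (((b : ℝ) : ℂ) * Complex.I) := by
  rw [Complex.exp_eq_exp_iff_exists_int]
  exact ⟨n, by rw [h]; push_cast; ring⟩

/-- `e^{iπ/2} = i`. [folklore] -/
private theorem cexp_pi_div_twoU : Complex.exp ((((π / 2 : ℝ)) : ℂ) * Complex.I) = Complex.I := by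
  rw [Complex.exp_mul_I]; push_cast
  rw [Complex.cos_pi_div_two, Complex.sin_pi_div_two]; simp

/-- `i · e^{ix} = e^{i(x + π/2)}`. [folklore] -/
private theorem I_mul_cexpU (x : ℝ) :
    Complex.I * Complex.exp (((x : ℝ) : ℂ) * Complex.I) = Complex.exp ((((x + π / 2 : ℝ)) : ℂ) * Complex.I) := by
  rw [show (((x + π / 2 : ℝ)) : ℂ) * Complex.I = ((x : ℝ) : ℂ) * Complex.I + (((π / 2 : ℝ)) : ℂ) * Complex.I by
    push_cast; ring, Complex.exp_add, cexp_pi_div_twoU]; ring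

/-- `−e^{ix} = e^{i(x + π)}`. [folklore] -/
private theorem neg_cexpU (x : ℝ) :
    -Complex.exp (((x : ℝ) : ℂ) * Complex.I) = Complex.exp ((((x + π : ℝ)) : ℂ) * Complex.I) := by
  rw [show (((x + π : ℝ)) : ℂ) * Complex.I = ((x : ℝ) : ℂ) * Complex.I + ((π : ℝ) : ℂ) * Complex.I by
    push_cast; ring, Complex.exp_add, Complex.exp_pi_mul_I]; ring

end HelpersU

/-! ## The universal sector-zero direction table -/

section Table

/-- ★ **THE UNIVERSAL SECTOR-ZERO DIRECTION TABLE** `dir₀(θ; z₀, z₁, z₂)` (symmetric in exit/return; junk `0` on the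
degenerate patterns): the unit complex number with `phase(τ(z₀))·ε(z₀;z₁,z₂)·backBracket(θ; z₀,z₁,z₂,z₃) = v(θ)·dir₀`, where
`τ(z₀) = headIn z₀ + (θ − π/2)·𝟙[z₀ slanted]` is the sector-zero prefix turning of the HEADING LAW. Values:
`W`: {S,N} ↦ `e^{i(-(π / 2))}`; `W`: {E,N} ↦ `e^{i(3 * θ / 8 - 5 * π / 8)}`; `W`: {E,S} ↦ `e^{i(3 * θ / 8 - 3 * π / 4)}`; `E`: {S,W} ↦ `e^{i(3 * θ / 8 - π / 4)}`; `E`: {N,W} ↦ `e^{i(3 * θ / 8 - 3 * π / 8)}`; `E`: {N,S} ↦ `e^{i(-(π / 8))}`; `S`: {W,N} ↦ `e^{i(-(π / 4))}`; `S`: {E,N} ↦ `e^{i(-(3 * π / 8))}`; `S`: {W,E} ↦ `e^{i(3 * θ / 8 - π / 2)}`; `N`: {W,S} ↦ `e^{i(-(3 * π / 4))}`; `N`: {E,S} ↦ `e^{i(-(5 * π / 8))}`; `N`: {E,W} ↦ `e^{i(3 * θ / 8 - 7 * π / 8)}`. Six entries are CONSTANT sixteenth roots of unity, six rotate as `e^{i·3θ/8}`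 times a sixteenth root of unity.
[cite: GlazmanManolescu2019, Lemma 2.1 (statement, "in the form given in [Gl]")] [cite: Glazman2015WeightedSAW, Lemma 3.1, eq. (1) (the weight v(θ))] -/
def dirZero (θ : ℝ) : Side → Side → Side → ℂ
  | .W, .S, .N => Complex.exp ((((-(π / 2) : ℝ)) : ℂ) * Complex.I)
  | .W, .N, .S => Complex.exp ((((-(π / 2) : ℝ)) : ℂ) * Complex.I)
  | .W, .E, .N => Complex.exp ((((3 * θ / 8 - 5 * π / 8 : ℝ)) : ℂ) * Complex.I)
  | .W, .N, .E => Complex.exp ((((3 * θ / 8 - 5 * π / 8 : ℝ)) : ℂ) * Complex.I)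
  | .W, .E, .S => Complex.exp ((((3 * θ / 8 - 3 * π / 4 : ℝ)) : ℂ) * Complex.I)
  | .W, .S, .E => Complex.exp ((((3 * θ / 8 - 3 * π / 4 : ℝ)) : ℂ) * Complex.I)
  | .E, .S, .W => Complex.exp ((((3 * θ / 8 - π / 4 : ℝ)) : ℂ) * Complex.I)
  | .E, .W, .S => Complex.exp ((((3 * θ / 8 - π / 4 : ℝ)) : ℂ) * Complex.I)
  | .E, .N, .W => Complex.exp ((((3 * θ / 8 - 3 * π / 8 : ℝ)) : ℂ) * Complex.I)
  | .E, .W, .N => Complex.exp ((((3 * θ / 8 - 3 * π / 8 : ℝ)) : ℂ) * Complex.I)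
  | .E, .N, .S => Complex.exp ((((-(π / 8) : ℝ)) : ℂ) * Complex.I)
  | .E, .S, .N => Complex.exp ((((-(π / 8) : ℝ)) : ℂ) * Complex.I)
  | .S, .W, .N => Complex.exp ((((-(π / 4) : ℝ)) : ℂ) * Complex.I)
  | .S, .N, .W => Complex.exp ((((-(π / 4) : ℝ)) : ℂ) * Complex.I)
  | .S, .E, .N => Complex.exp ((((-(3 * π / 8) : ℝ)) : ℂ) * Complex.I)
  | .S, .N, .E => Complex.exp ((((-(3 * π / 8) : ℝ)) : ℂ) * Complex.I)
  | .S, .W, .E => Complex.exp ((((3 * θ / 8 - π / 2 : ℝ)) : ℂ) * Complex.I)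
  | .S, .E, .W => Complex.exp ((((3 * θ / 8 - π / 2 : ℝ)) : ℂ) * Complex.I)
  | .N, .W, .S => Complex.exp ((((-(3 * π / 4) : ℝ)) : ℂ) * Complex.I)
  | .N, .S, .W => Complex.exp ((((-(3 * π / 4) : ℝ)) : ℂ) * Complex.I)
  | .N, .E, .S => Complex.exp ((((-(5 * π / 8) : ℝ)) : ℂ) * Complex.I)
  | .N, .S, .E => Complex.exp ((((-(5 * π / 8) : ℝ)) : ℂ) * Complex.I)
  | .N, .E, .W => Complex.exp ((((3 * θ / 8 - 7 * π / 8 : ℝ)) : ℂ) * Complex.I)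
  | .N, .W, .E => Complex.exp ((((3 * θ / 8 - 7 * π / 8 : ℝ)) : ℂ) * Complex.I)
  | _, _, _ => 0

/-- First side `W`, class `{S, N}`: `phase(τ(W))·ε·backBracket = v(θ)·e^{i(-(π / 2))}` (private; the public form is
`dir_term_universal`). [cite: Glazman2015WeightedSAW, Lemma 3.1, eq. (1) (the weight v(θ))] [cite: GlazmanManolescu2019, Lemma 2.1 (proof: [Gl])] -/
private theorem dir0_term_W_S_N (θ : ℝ) :
    phase (Side.headIn .W + (θ - π / 2) * Side.slantInd .W) *
        ((chordSign .W .S .N : ℂ) * backBracket θ .W .S .N .E) =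
      (weightV θ : ℂ) * dirZero θ .W .S .N := by
  have ht : Side.headIn .W + (θ - π / 2) * Side.slantInd .W = 0 := by
    simp only [Side.headIn, Side.slantInd]; ring
  have hcs : ((chordSign .W .S .N : ℤ) : ℂ) = -1 := by
    rw [show chordSign .W .S .N = -1 by decide]; simp
  rw [ht, backBracket_W_S_N_E, phase, hcs, dirZero]
  have f : -(Complex.I * Complex.exp ((((-(5 / 8 * (0))) : ℝ) : ℂ) * Complex.I)) = Complex.exp ((((-(π / 2) : ℝ)) : ℂ) * Complex.I) := by
    rw [I_mul_cexpU, neg_cexpU]; exact cexp_I_eq_of_intU _ _ (1) (by push_cast; ring)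
  linear_combination (weightV θ : ℂ) * f

/-- First side `W`, class `{E, N}`: `phase(τ(W))·ε·backBracket = v(θ)·e^{i(3 * θ / 8 - 5 * π / 8)}` (private; the public form is
`dir_term_universal`). [cite: Glazman2015WeightedSAW, Lemma 3.1, eq. (1) (the weight v(θ))] [cite: GlazmanManolescu2019, Lemma 2.1 (proof: [Gl])] -/
private theorem dir0_term_W_E_N (θ : ℝ) :
    phase (Side.headIn .W + (θ - π / 2) * Side.slantInd .W) *
        ((chordSign .W .E .N : ℂ) * backBracket θ .W .E .N .S) =
      (weightV θ : ℂ) * dirZero θ .W .E .N := by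
  have ht : Side.headIn .W + (θ - π / 2) * Side.slantInd .W = 0 := by
    simp only [Side.headIn, Side.slantInd]; ring
  have hcs : ((chordSign .W .E .N : ℤ) : ℂ) = -1 := by
    rw [show chordSign .W .E .N = -1 by decide]; simp
  rw [ht, backBracket_W_E_N_S, phase, hcs, dirZero]
  have f : -(Complex.I * (Complex.exp ((((-(5 / 8 * (0))) : ℝ) : ℂ) * Complex.I) * Complex.exp ((((3 * θ / 8 - π / 8 : ℝ)) : ℂ) * Complex.I))) = Complex.exp ((((3 * θ / 8 - 5 * π / 8 : ℝ)) : ℂ) * Complex.I) := by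
    rw [cexp_mul_cexpU, I_mul_cexpU, neg_cexpU]; exact cexp_I_eq_of_intU _ _ (1) (by push_cast; ring)
  linear_combination (weightV θ : ℂ) * f

/-- First side `W`, class `{E, S}`: `phase(τ(W))·ε·backBracket = v(θ)·e^{i(3 * θ / 8 - 3 * π / 4)}` (private; the public form is
`dir_term_universal`). [cite: Glazman2015WeightedSAW, Lemma 3.1, eq. (1) (the weight v(θ))] [cite: GlazmanManolescu2019, Lemma 2.1 (proof: [Gl])] -/
private theorem dir0_term_W_E_S (θ : ℝ) :
    phase (Side.headIn .W + (θ - π / 2) * Side.slantInd .W) *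
        ((chordSign .W .E .S : ℂ) * backBracket θ .W .E .S .N) =
      (weightV θ : ℂ) * dirZero θ .W .E .S := by
  have ht : Side.headIn .W + (θ - π / 2) * Side.slantInd .W = 0 := by
    simp only [Side.headIn, Side.slantInd]; ring
  have hcs : ((chordSign .W .E .S : ℤ) : ℂ) = 1 := by
    rw [show chordSign .W .E .S = 1 by decide]; simp
  rw [ht, backBracket_W_E_S_N, phase, hcs, dirZero]
  have f : -(Complex.I * (Complex.exp ((((-(5 / 8 * (0))) : ℝ) : ℂ) * Complex.I) * Complex.exp ((((3 * θ / 8 - π / 4 : ℝ)) : ℂ) * Complex.I))) = Complex.exp ((((3 * θ / 8 - 3 * π / 4 : ℝ)) : ℂ) * Complex.I) := by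
    rw [cexp_mul_cexpU, I_mul_cexpU, neg_cexpU]; exact cexp_I_eq_of_intU _ _ (1) (by push_cast; ring)
  linear_combination (weightV θ : ℂ) * f

/-- First side `E`, class `{S, W}`: `phase(τ(E))·ε·backBracket = v(θ)·e^{i(3 * θ / 8 - π / 4)}` (private; the public form is
`dir_term_universal`). [cite: Glazman2015WeightedSAW, Lemma 3.1, eq. (1) (the weight v(θ))] [cite: GlazmanManolescu2019, Lemma 2.1 (proof: [Gl])] -/
private theorem dir0_term_E_S_W (θ : ℝ) :
    phase (Side.headIn .E + (θ - π / 2) * Side.slantInd .E) *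
        ((chordSign .E .S .W : ℂ) * backBracket θ .E .S .W .N) =
      (weightV θ : ℂ) * dirZero θ .E .S .W := by
  have ht : Side.headIn .E + (θ - π / 2) * Side.slantInd .E = π := by
    simp only [Side.headIn, Side.slantInd]; ring
  have hcs : ((chordSign .E .S .W : ℤ) : ℂ) = 1 := by
    rw [show chordSign .E .S .W = 1 by decide]; simp
  rw [ht, backBracket_E_S_W_N, phase, hcs, dirZero]
  have f : -(Complex.exp ((((-(5 / 8 * (π))) : ℝ) : ℂ) * Complex.I) * Complex.exp ((((3 * θ / 8 - 5 * π / 8 : ℝ)) : ℂ) * Complex.I)) = Complex.exp ((((3 * θ / 8 - π / 4 : ℝ)) : ℂ) * Complex.I) := by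
    rw [cexp_mul_cexpU, neg_cexpU]; exact cexp_I_eq_of_intU _ _ (0) (by push_cast; ring)
  linear_combination (weightV θ : ℂ) * f

/-- First side `E`, class `{N, W}`: `phase(τ(E))·ε·backBracket = v(θ)·e^{i(3 * θ / 8 - 3 * π / 8)}` (private; the public form is
`dir_term_universal`). [cite: Glazman2015WeightedSAW, Lemma 3.1, eq. (1) (the weight v(θ))] [cite: GlazmanManolescu2019, Lemma 2.1 (proof: [Gl])] -/
private theorem dir0_term_E_N_W (θ : ℝ) :
    phase (Side.headIn .E + (θ - π / 2) * Side.slantInd .E) *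
        ((chordSign .E .N .W : ℂ) * backBracket θ .E .N .W .S) =
      (weightV θ : ℂ) * dirZero θ .E .N .W := by
  have ht : Side.headIn .E + (θ - π / 2) * Side.slantInd .E = π := by
    simp only [Side.headIn, Side.slantInd]; ring
  have hcs : ((chordSign .E .N .W : ℤ) : ℂ) = -1 := by
    rw [show chordSign .E .N .W = -1 by decide]; simp
  rw [ht, backBracket_E_N_W_S, phase, hcs, dirZero]
  have f : -(Complex.exp ((((-(5 / 8 * (π))) : ℝ) : ℂ) * Complex.I) * Complex.exp ((((3 * θ / 8 + 5 * π / 4 : ℝ)) : ℂ) * Complex.I)) = Complex.exp ((((3 * θ / 8 - 3 * π / 8 : ℝ)) : ℂ) * Complex.I) := by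
    rw [cexp_mul_cexpU, neg_cexpU]; exact cexp_I_eq_of_intU _ _ (1) (by push_cast; ring)
  linear_combination (weightV θ : ℂ) * f

/-- First side `E`, class `{N, S}`: `phase(τ(E))·ε·backBracket = v(θ)·e^{i(-(π / 8))}` (private; the public form is
`dir_term_universal`). [cite: Glazman2015WeightedSAW, Lemma 3.1, eq. (1) (the weight v(θ))] [cite: GlazmanManolescu2019, Lemma 2.1 (proof: [Gl])] -/
private theorem dir0_term_E_N_S (θ : ℝ) :
    phase (Side.headIn .E + (θ - π / 2) * Side.slantInd .E) *
        ((chordSign .E .N .S : ℂ) * backBracket θ .E .N .S .W) =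
      (weightV θ : ℂ) * dirZero θ .E .N .S := by
  have ht : Side.headIn .E + (θ - π / 2) * Side.slantInd .E = π := by
    simp only [Side.headIn, Side.slantInd]; ring
  have hcs : ((chordSign .E .N .S : ℤ) : ℂ) = -1 := by
    rw [show chordSign .E .N .S = -1 by decide]; simp
  rw [ht, backBracket_E_N_S_W, phase, hcs, dirZero]
  have f : Complex.I * Complex.exp ((((-(5 / 8 * (π))) : ℝ) : ℂ) * Complex.I) = Complex.exp ((((-(π / 8) : ℝ)) : ℂ) * Complex.I) := by
    rw [I_mul_cexpU]; exact cexp_I_eq_of_intU _ _ (0) (by push_cast; ring)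
  linear_combination (weightV θ : ℂ) * f

/-- First side `S`, class `{W, N}`: `phase(τ(S))·ε·backBracket = v(θ)·e^{i(-(π / 4))}` (private; the public form is
`dir_term_universal`). [cite: Glazman2015WeightedSAW, Lemma 3.1, eq. (1) (the weight v(θ))] [cite: GlazmanManolescu2019, Lemma 2.1 (proof: [Gl])] -/
private theorem dir0_term_S_W_N (θ : ℝ) :
    phase (Side.headIn .S + (θ - π / 2) * Side.slantInd .S) *
        ((chordSign .S .W .N : ℂ) * backBracket θ .S .W .N .E) =
      (weightV θ : ℂ) * dirZero θ .S .W .N := by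
  have ht : Side.headIn .S + (θ - π / 2) * Side.slantInd .S = θ := by
    simp only [Side.headIn, Side.slantInd]; ring
  have hcs : ((chordSign .S .W .N : ℤ) : ℂ) = 1 := by
    rw [show chordSign .S .W .N = 1 by decide]; simp
  rw [ht, backBracket_S_W_N_E, phase, hcs, dirZero]
  have f : -(Complex.exp ((((-(5 / 8 * (θ))) : ℝ) : ℂ) * Complex.I) * Complex.exp ((((5 * θ / 8 - 5 * π / 4 : ℝ)) : ℂ) * Complex.I)) = Complex.exp ((((-(π / 4) : ℝ)) : ℂ) * Complex.I) := by
    rw [cexp_mul_cexpU, neg_cexpU]; exact cexp_I_eq_of_intU _ _ (0) (by push_cast; ring)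
  linear_combination (weightV θ : ℂ) * f

/-- First side `S`, class `{E, N}`: `phase(τ(S))·ε·backBracket = v(θ)·e^{i(-(3 * π / 8))}` (private; the public form is
`dir_term_universal`). [cite: Glazman2015WeightedSAW, Lemma 3.1, eq. (1) (the weight v(θ))] [cite: GlazmanManolescu2019, Lemma 2.1 (proof: [Gl])] -/
private theorem dir0_term_S_E_N (θ : ℝ) :
    phase (Side.headIn .S + (θ - π / 2) * Side.slantInd .S) *
        ((chordSign .S .E .N : ℂ) * backBracket θ .S .E .N .W) =
      (weightV θ : ℂ) * dirZero θ .S .E .N := by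
  have ht : Side.headIn .S + (θ - π / 2) * Side.slantInd .S = θ := by
    simp only [Side.headIn, Side.slantInd]; ring
  have hcs : ((chordSign .S .E .N : ℤ) : ℂ) = -1 := by
    rw [show chordSign .S .E .N = -1 by decide]; simp
  rw [ht, backBracket_S_E_N_W, phase, hcs, dirZero]
  have f : -(Complex.exp ((((-(5 / 8 * (θ))) : ℝ) : ℂ) * Complex.I) * Complex.exp ((((5 * θ / 8 + 5 * π / 8 : ℝ)) : ℂ) * Complex.I)) = Complex.exp ((((-(3 * π / 8) : ℝ)) : ℂ) * Complex.I) := by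
    rw [cexp_mul_cexpU, neg_cexpU]; exact cexp_I_eq_of_intU _ _ (1) (by push_cast; ring)
  linear_combination (weightV θ : ℂ) * f

/-- First side `S`, class `{W, E}`: `phase(τ(S))·ε·backBracket = v(θ)·e^{i(3 * θ / 8 - π / 2)}` (private; the public form is
`dir_term_universal`). [cite: Glazman2015WeightedSAW, Lemma 3.1, eq. (1) (the weight v(θ))] [cite: GlazmanManolescu2019, Lemma 2.1 (proof: [Gl])] -/
private theorem dir0_term_S_W_E (θ : ℝ) :
    phase (Side.headIn .S + (θ - π / 2) * Side.slantInd .S) *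
        ((chordSign .S .W .E : ℂ) * backBracket θ .S .W .E .N) =
      (weightV θ : ℂ) * dirZero θ .S .W .E := by
  have ht : Side.headIn .S + (θ - π / 2) * Side.slantInd .S = θ := by
    simp only [Side.headIn, Side.slantInd]; ring
  have hcs : ((chordSign .S .W .E : ℤ) : ℂ) = 1 := by
    rw [show chordSign .S .W .E = 1 by decide]; simp
  rw [ht, backBracket_S_W_E_N, phase, hcs, dirZero]
  have f : -(Complex.I * (Complex.exp ((((-(5 / 8 * (θ))) : ℝ) : ℂ) * Complex.I) * Complex.exp ((θ : ℂ) * Complex.I))) = Complex.exp ((((3 * θ / 8 - π / 2 : ℝ)) : ℂ) * Complex.I) := by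
    rw [cexp_mul_cexp_thetaU, I_mul_cexpU, neg_cexpU]; exact cexp_I_eq_of_intU _ _ (1) (by push_cast; ring)
  linear_combination (weightV θ : ℂ) * f

/-- First side `N`, class `{W, S}`: `phase(τ(N))·ε·backBracket = v(θ)·e^{i(-(3 * π / 4))}` (private; the public form is
`dir_term_universal`). [cite: Glazman2015WeightedSAW, Lemma 3.1, eq. (1) (the weight v(θ))] [cite: GlazmanManolescu2019, Lemma 2.1 (proof: [Gl])] -/
private theorem dir0_term_N_W_S (θ : ℝ) :
    phase (Side.headIn .N + (θ - π / 2) * Side.slantInd .N) *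
        ((chordSign .N .W .S : ℂ) * backBracket θ .N .W .S .E) =
      (weightV θ : ℂ) * dirZero θ .N .W .S := by
  have ht : Side.headIn .N + (θ - π / 2) * Side.slantInd .N = θ - π := by
    simp only [Side.headIn, Side.slantInd]; ring
  have hcs : ((chordSign .N .W .S : ℤ) : ℂ) = -1 := by
    rw [show chordSign .N .W .S = -1 by decide]; simp
  rw [ht, backBracket_N_W_S_E, phase, hcs, dirZero]
  have f : Complex.exp ((((-(5 / 8 * (θ - π))) : ℝ) : ℂ) * Complex.I) * Complex.exp ((((5 * θ / 8 + 5 * π / 8 : ℝ)) : ℂ) * Complex.I) = Complex.exp ((((-(3 * π / 4) : ℝ)) : ℂ) * Complex.I) := by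
    rw [cexp_mul_cexpU]; exact cexp_I_eq_of_intU _ _ (1) (by push_cast; ring)
  linear_combination (weightV θ : ℂ) * f

/-- First side `N`, class `{E, S}`: `phase(τ(N))·ε·backBracket = v(θ)·e^{i(-(5 * π / 8))}` (private; the public form is
`dir_term_universal`). [cite: Glazman2015WeightedSAW, Lemma 3.1, eq. (1) (the weight v(θ))] [cite: GlazmanManolescu2019, Lemma 2.1 (proof: [Gl])] -/
private theorem dir0_term_N_E_S (θ : ℝ) :
    phase (Side.headIn .N + (θ - π / 2) * Side.slantInd .N) *
        ((chordSign .N .E .S : ℂ) * backBracket θ .N .E .S .W) =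
      (weightV θ : ℂ) * dirZero θ .N .E .S := by
  have ht : Side.headIn .N + (θ - π / 2) * Side.slantInd .N = θ - π := by
    simp only [Side.headIn, Side.slantInd]; ring
  have hcs : ((chordSign .N .E .S : ℤ) : ℂ) = 1 := by
    rw [show chordSign .N .E .S = 1 by decide]; simp
  rw [ht, backBracket_N_E_S_W, phase, hcs, dirZero]
  have f : Complex.exp ((((-(5 / 8 * (θ - π))) : ℝ) : ℂ) * Complex.I) * Complex.exp ((((5 * θ / 8 - 5 * π / 4 : ℝ)) : ℂ) * Complex.I) = Complex.exp ((((-(5 * π / 8) : ℝ)) : ℂ) * Complex.I) := by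
    rw [cexp_mul_cexpU]; exact cexp_I_eq_of_intU _ _ (0) (by push_cast; ring)
  linear_combination (weightV θ : ℂ) * f

/-- First side `N`, class `{E, W}`: `phase(τ(N))·ε·backBracket = v(θ)·e^{i(3 * θ / 8 - 7 * π / 8)}` (private; the public form is
`dir_term_universal`). [cite: Glazman2015WeightedSAW, Lemma 3.1, eq. (1) (the weight v(θ))] [cite: GlazmanManolescu2019, Lemma 2.1 (proof: [Gl])] -/
private theorem dir0_term_N_E_W (θ : ℝ) :
    phase (Side.headIn .N + (θ - π / 2) * Side.slantInd .N) *
        ((chordSign .N .E .W : ℂ) * backBracket θ .N .E .W .S) =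
      (weightV θ : ℂ) * dirZero θ .N .E .W := by
  have ht : Side.headIn .N + (θ - π / 2) * Side.slantInd .N = θ - π := by
    simp only [Side.headIn, Side.slantInd]; ring
  have hcs : ((chordSign .N .E .W : ℤ) : ℂ) = 1 := by
    rw [show chordSign .N .E .W = 1 by decide]; simp
  rw [ht, backBracket_N_E_W_S, phase, hcs, dirZero]
  have f : Complex.I * (Complex.exp ((((-(5 / 8 * (θ - π))) : ℝ) : ℂ) * Complex.I) * Complex.exp ((θ : ℂ) * Complex.I)) = Complex.exp ((((3 * θ / 8 - 7 * π / 8 : ℝ)) : ℂ) * Complex.I) := by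
    rw [cexp_mul_cexp_thetaU, I_mul_cexpU]; exact cexp_I_eq_of_intU _ _ (1) (by push_cast; ring)
  linear_combination (weightV θ : ℂ) * f

/-- The twelve directly listed ordered patterns (one orientation per class). [folklore] -/
def dirZeroPatterns : List (Side × Side × Side) := [(.W, .S, .N), (.W, .E, .N), (.W, .E, .S), (.E, .S, .W), (.E, .N, .W), (.E, .N, .S), (.S, .W, .N), (.S, .E, .N), (.S, .W, .E), (.N, .W, .S), (.N, .E, .S), (.N, .E, .W)]

/-- ★ The universal direction identity on the listed patterns. [cite: GlazmanManolescu2019, Lemma 2.1 (statement, "in the form given in [Gl]")] [cite: Glazman2015WeightedSAW, Lemma 3.1, eq. (1) (the weight v(θ))] -/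
theorem dir_term_universal_of_mem (θ : ℝ) {z₀ z₁ z₂ z₃ : Side} (hmem : (z₀, z₁, z₂) ∈ dirZeroPatterns)
    (h3 : z₃ ≠ z₀ ∧ z₃ ≠ z₁ ∧ z₃ ≠ z₂) :
    phase (z₀.headIn + (θ - π / 2) * z₀.slantInd) * ((chordSign z₀ z₁ z₂ : ℂ) * backBracket θ z₀ z₁ z₂ z₃) =
      (weightV θ : ℂ) * dirZero θ z₀ z₁ z₂ := by
  obtain ⟨h3a, h3b, h3c⟩ := h3
  simp only [dirZeroPatterns, List.mem_cons, Prod.mk.injEq, List.mem_nil_iff, or_false] at hmem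
  rcases hmem with ⟨rfl, rfl, rfl⟩ | ⟨rfl, rfl, rfl⟩ | ⟨rfl, rfl, rfl⟩ | ⟨rfl, rfl, rfl⟩ | ⟨rfl, rfl, rfl⟩ | ⟨rfl, rfl, rfl⟩ | ⟨rfl, rfl, rfl⟩ | ⟨rfl, rfl, rfl⟩ | ⟨rfl, rfl, rfl⟩ | ⟨rfl, rfl, rfl⟩ | ⟨rfl, rfl, rfl⟩ | ⟨rfl, rfl, rfl⟩
  · obtain rfl : z₃ = .E := by revert h3a h3b h3c; cases z₃ <;> simp
    exact dir0_term_W_S_N θ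
  · obtain rfl : z₃ = .S := by revert h3a h3b h3c; cases z₃ <;> simp
    exact dir0_term_W_E_N θ
  · obtain rfl : z₃ = .N := by revert h3a h3b h3c; cases z₃ <;> simp
    exact dir0_term_W_E_S θ
  · obtain rfl : z₃ = .N := by revert h3a h3b h3c; cases z₃ <;> simp
    exact dir0_term_E_S_W θ
  · obtain rfl : z₃ = .S := by revert h3a h3b h3c; cases z₃ <;> simp
    exact dir0_term_E_N_W θ
  · obtain rfl : z₃ = .W := by revert h3a h3b h3c; cases z₃ <;> simp
    exact dir0_term_E_N_S θ
  · obtain rfl : z₃ = .E := by revert h3a h3b h3c; cases z₃ <;> simp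
    exact dir0_term_S_W_N θ
  · obtain rfl : z₃ = .W := by revert h3a h3b h3c; cases z₃ <;> simp
    exact dir0_term_S_E_N θ
  · obtain rfl : z₃ = .N := by revert h3a h3b h3c; cases z₃ <;> simp
    exact dir0_term_S_W_E θ
  · obtain rfl : z₃ = .E := by revert h3a h3b h3c; cases z₃ <;> simp
    exact dir0_term_N_W_S θ
  · obtain rfl : z₃ = .W := by revert h3a h3b h3c; cases z₃ <;> simp
    exact dir0_term_N_E_S θ
  · obtain rfl : z₃ = .S := by revert h3a h3b h3c; cases z₃ <;> simp
    exact dir0_term_N_E_W θ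

/-- The universal table is symmetric in the exit and return sides (a class is an unordered pair of doors).
[cite: Glazman2015WeightedSAW, Lemma 3.1 (proof, pp. 6–7: the classes of walks through a rhombus); lane plumbing] -/
theorem dirZero_swap (θ : ℝ) (z₀ z₁ z₂ : Side) : dirZero θ z₀ z₂ z₁ = dirZero θ z₀ z₁ z₂ := by
  cases z₀ <;> cases z₁ <;> cases z₂ <;> rfl

/-- Every admissible pattern (`z₀, z₁, z₂` pairwise distinct) is listed directly or reversed. [folklore] -/
private theorem dirZeroPatterns_cover : ∀ a b c : Side, a ≠ b → a ≠ c → b ≠ c →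
    (a, b, c) ∈ dirZeroPatterns ∨ (a, c, b) ∈ dirZeroPatterns := by decide

/-- ★★ **THE UNIVERSAL DIRECTION IDENTITY.** For every admissible pattern (`z₀, z₁, z₂, z₃` pairwise distinct):
`phase(headIn z₀ + (θ − π/2)·𝟙[z₀ slanted]) · ε(z₀; z₁, z₂) · backBracket(θ; z₀, z₁, z₂, z₃) = v(θ) · dir₀(θ; z₀, z₁, z₂)`.
[cite: GlazmanManolescu2019, Lemma 2.1 (statement, "in the form given in [Gl]")] [cite: Glazman2015WeightedSAW, Lemma 3.1, eq. (1) (the weight v(θ))] -/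
theorem dir_term_universal (θ : ℝ) {z₀ z₁ z₂ z₃ : Side} (h01 : z₀ ≠ z₁) (h02 : z₀ ≠ z₂) (h12 : z₁ ≠ z₂)
    (h3 : z₃ ≠ z₀ ∧ z₃ ≠ z₁ ∧ z₃ ≠ z₂) :
    phase (z₀.headIn + (θ - π / 2) * z₀.slantInd) * ((chordSign z₀ z₁ z₂ : ℂ) * backBracket θ z₀ z₁ z₂ z₃) =
      (weightV θ : ℂ) * dirZero θ z₀ z₁ z₂ := by
  rcases dirZeroPatterns_cover _ _ _ h01 h02 h12 with hd | hd
  · exact dir_term_universal_of_mem θ hd h3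
  · rw [← ΩG.chordSign_mul_backBracket_swap θ h01 h02 (Ne.symm h3.1) h12 (Ne.symm h3.2.1) (Ne.symm h3.2.2),
      ← dirZero_swap]
    exact dir_term_universal_of_mem θ hd ⟨h3.1, h3.2.2, h3.2.1⟩

/-- ★ The universal directions are units: `|dir₀(θ; z₀, z₁, z₂)| = 1` on admissible patterns.
[cite: Glazman2015WeightedSAW, Lemma 3.1, eq. (1) (the weight v(θ))] -/
theorem norm_dirZero (θ : ℝ) {z₀ z₁ z₂ : Side} (h01 : z₀ ≠ z₁) (h02 : z₀ ≠ z₂) (h12 : z₁ ≠ z₂) :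
    ‖dirZero θ z₀ z₁ z₂‖ = 1 := by
  cases z₀ <;> cases z₁ <;> cases z₂ <;> simp only [dirZero] <;>
    first
    | exact absurd rfl h01
    | exact absurd rfl h02
    | exact absurd rfl h12
    | exact Complex.norm_exp_ofReal_mul_I _

/-- The universal directions never vanish on admissible patterns. [cite: Glazman2015WeightedSAW, Lemma 3.1, eq. (1) (the weight v(θ))] -/
theorem dirZero_ne_zero (θ : ℝ) {z₀ z₁ z₂ : Side} (h01 : z₀ ≠ z₁) (h02 : z₀ ≠ z₂) (h12 : z₁ ≠ z₂) :
    dirZero θ z₀ z₁ z₂ ≠ 0 := by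
  rw [← norm_pos_iff, norm_dirZero θ h01 h02 h12]; exact one_pos

end Table


/-! ## The direction alphabet: sixteen constant and sixteen rotating directions -/

section Alphabet

/-- ★★ **THE SECTOR-ZERO ALPHABET.** On admissible patterns `dir₀(θ; z₀, z₁, z₂)` is either a CONSTANT sixteenth root of unity
`e^{iπm/8}` or a ROTATING one `e^{i(3θ/8 + πm/8)}` (`m ∈ ℤ`). [cite: Glazman2015WeightedSAW, Lemma 3.1, eq. (1) (the weight v(θ))] -/
theorem dirZero_mem_alphabet (θ : ℝ) {z₀ z₁ z₂ : Side} (h01 : z₀ ≠ z₁) (h02 : z₀ ≠ z₂) (h12 : z₁ ≠ z₂) :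
    ∃ m : ℤ, dirZero θ z₀ z₁ z₂ = Complex.exp ((((π * m / 8 : ℝ)) : ℂ) * Complex.I) ∨
      dirZero θ z₀ z₁ z₂ = Complex.exp ((((3 * θ / 8 + π * m / 8 : ℝ)) : ℂ) * Complex.I) := by
  cases z₀ <;> cases z₁ <;> cases z₂ <;>
    first
    | exact absurd rfl h01
    | exact absurd rfl h02
    | exact absurd rfl h12
    | (refine ⟨-4, Or.inl ?_⟩; rw [dirZero]; congr 1; push_cast; ring1)
    | (refine ⟨-1, Or.inl ?_⟩; rw [dirZero]; congr 1; push_cast; ring1)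
    | (refine ⟨-2, Or.inl ?_⟩; rw [dirZero]; congr 1; push_cast; ring1)
    | (refine ⟨-3, Or.inl ?_⟩; rw [dirZero]; congr 1; push_cast; ring1)
    | (refine ⟨-6, Or.inl ?_⟩; rw [dirZero]; congr 1; push_cast; ring1)
    | (refine ⟨-5, Or.inl ?_⟩; rw [dirZero]; congr 1; push_cast; ring1)
    | (refine ⟨-5, Or.inr ?_⟩; rw [dirZero]; congr 1; push_cast; ring1)
    | (refine ⟨-6, Or.inr ?_⟩; rw [dirZero]; congr 1; push_cast; ring1)
    | (refine ⟨-2, Or.inr ?_⟩; rw [dirZero]; congr 1; push_cast; ring1)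
    | (refine ⟨-3, Or.inr ?_⟩; rw [dirZero]; congr 1; push_cast; ring1)
    | (refine ⟨-4, Or.inr ?_⟩; rw [dirZero]; congr 1; push_cast; ring1)
    | (refine ⟨-7, Or.inr ?_⟩; rw [dirZero]; congr 1; push_cast; ring1)

end Alphabet

/-! ## Faces against the ring's per-cell tables (values only) -/

section Faces

/-- Face `LS`, first side `W` (sector `k = 1`): `dir₀(θ; W, E, S)·phase(2π) = e^{i·3θ/8}` — the value of the ring file's
`dirLS θ W E S`. [cite: Glazman2015WeightedSAW, Lemma 3.1, eq. (1) (the weight v(θ))] -/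
theorem dirZero_W_E_S_mul_phase_two_pi (θ : ℝ) :
    dirZero θ .W .E .S * phase (2 * π) = Complex.exp ((((3 * θ / 8 : ℝ)) : ℂ) * Complex.I) := by
  rw [dirZero, phase, cexp_mul_cexpU]
  exact cexp_I_eq_of_intU _ _ (-1) (by ring)

/-- Face `LS`, first side `E` (sector `k = −1`): `dir₀(θ; E, S, W)·phase(−2π) = e^{i(3θ/8 + π)}` — the value of the ring
file's `dirLS θ E S W`. [cite: Glazman2015WeightedSAW, Lemma 3.1, eq. (1) (the weight v(θ))] -/
theorem dirZero_E_S_W_mul_phase_neg_two_pi (θ : ℝ) :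
    dirZero θ .E .S .W * phase (-(2 * π)) = Complex.exp ((((3 * θ / 8 + π : ℝ)) : ℂ) * Complex.I) := by
  rw [dirZero, phase, cexp_mul_cexpU]
  exact cexp_I_eq_of_intU _ _ (0) (by ring)

/-- Face `LN`, first side `E` (sector `0`): `dir₀(θ; E, N, W) = e^{i(3θ/8 − 3π/8)}` — the value of the ring file's
`dirLN θ E N W`. [cite: Glazman2015WeightedSAW, Lemma 3.1, eq. (1) (the weight v(θ))] -/
theorem dirZero_E_N_W (θ : ℝ) :
    dirZero θ .E .N .W = Complex.exp ((((3 * θ / 8 - 3 * π / 8 : ℝ)) : ℂ) * Complex.I) := rfl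

/-- Face `SE`, first side `N` (sector `0`): `dir₀(θ; N, E, S) = e^{−i5π/8}` — the value of the ring file's `dirSE θ N E S`.
[cite: Glazman2015WeightedSAW, Lemma 3.1, eq. (1) (the weight v(θ))] -/
theorem dirZero_N_E_S (θ : ℝ) :
    dirZero θ .N .E .S = Complex.exp ((((-(5 * π / 8) : ℝ)) : ℂ) * Complex.I) := rfl

/-- Face `NE`, first side `S` (sector `0`): `dir₀(θ; S, W, N) = e^{−iπ/4}` — the value of the ring file's `dirNE θ S W N`.
[cite: Glazman2015WeightedSAW, Lemma 3.1, eq. (1) (the weight v(θ))] -/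
theorem dirZero_S_W_N (θ : ℝ) :
    dirZero θ .S .W .N = Complex.exp ((((-(π / 4) : ℝ)) : ℂ) * Complex.I) := rfl

end Faces

/-! ## The class term of a wound excursion at an arbitrary cell -/

namespace ΩG

variable {D : Set Face} {w r : Face}

/-- ★★★ **UNIVERSAL FORM OF THE CLASS TERM, at an arbitrary cell.** For a WOUND class-`B2a` walk `ω` at any rooted
plaquette `r` of a `W`-normalised hole root (non-empty prefix): `classTerm(θ) = v(θ)·ext(θ)·dir₀(θ; z₀, z₁, z₂)·phase(2πk)`
for an integer `k` (the sector of the prefix; `phase(2πk) = e^{−i5πk/4}`). [cite: GlazmanManolescu2019, Lemma 2.1 (statement, "in the form given in [Gl]")]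
[cite: Glazman2015WeightedSAW, Lemma 3.1 (proof, pp. 6–7: the classes of walks through a rhombus)] -/
theorem classTerm_universal_form (hh : ((w.1 - 1, w.2) : Face) ∉ D) (ω : ΩG D (w.side .W) r)
    (hr : RootedFace D (w.side .W) r) (h : ω.IsB2a) (h0 : 0 < ω.2.firstHitG) (θ : ℝ)
    (hW : ω.WE (fun _ => θ) ≠ excursionWinding θ ω.2.firstSideG (ω.z1 hr h) ω.1) :
    ∃ k : ℤ, ω.classTerm (fun _ => θ) hr =
      (weightV θ : ℂ) * (ω.2.extWeight (fun _ => θ) r : ℂ) * dirZero θ ω.2.firstSideG (ω.z1 hr h) ω.1 *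
        phase (2 * π * k) := by
  obtain ⟨k, hk⟩ := ω.classTerm_sector_form hh hr h h0 θ hW
  obtain ⟨hz01, hz02, hz12⟩ := ω.firstSide_exit_return_distinct hr h
  have h3 := ω.z₃_spec hr h
  have H := dir_term_universal θ hz01 hz02 hz12 ⟨h3.1, h3.2.1, h3.2.2⟩
  refine ⟨k, ?_⟩
  rw [hk]
  linear_combination ((ω.2.extWeight (fun _ => θ) r : ℂ) * phase (2 * π * k)) * H

/-- **Zero or universal form** (the dichotomy restated): at any cell of a `W`-normalised hole root a class-`B2a` walk
with non-empty prefix is either unwound with class term `0`, or wound with class term `v·ext·dir₀·phase(2πk)`.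
[cite: GlazmanManolescu2019, Lemma 2.1 (statement, "in the form given in [Gl]")] [cite: Glazman2015WeightedSAW, Lemma 3.1 (proof, pp. 6–7)] -/
theorem classTerm_zero_or_universal (hh : ((w.1 - 1, w.2) : Face) ∉ D) (ω : ΩG D (w.side .W) r)
    (hr : RootedFace D (w.side .W) r) (h : ω.IsB2a) (h0 : 0 < ω.2.firstHitG) (θ : ℝ) :
    (ω.WE (fun _ => θ) = excursionWinding θ ω.2.firstSideG (ω.z1 hr h) ω.1 ∧ ω.classTerm (fun _ => θ) hr = 0) ∨
      (ω.WE (fun _ => θ) ≠ excursionWinding θ ω.2.firstSideG (ω.z1 hr h) ω.1 ∧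
        ∃ k : ℤ, ω.classTerm (fun _ => θ) hr =
          (weightV θ : ℂ) * (ω.2.extWeight (fun _ => θ) r : ℂ) * dirZero θ ω.2.firstSideG (ω.z1 hr h) ω.1 *
            phase (2 * π * k)) := by
  rcases ω.classTerm_dichotomy hr h θ with ⟨hWE, h0'⟩ | ⟨hW, -⟩
  · exact Or.inl ⟨hWE, h0'⟩
  · exact Or.inr ⟨hW, ω.classTerm_universal_form hh hr h h0 θ hW⟩

/-- ★★★ **THE DIRECTION ALPHABET OF A WOUND EXCURSION, at an arbitrary cell.** For every WOUND class-`B2a` walk at any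
rooted plaquette of a `W`-normalised hole root (non-empty prefix) there is an integer `j` with
`classTerm(θ) = v(θ)·ext(θ)·e^{iπj/8}` (constant direction) or `classTerm(θ) = v(θ)·ext(θ)·e^{i(3θ/8 + πj/8)}` (rotating
direction): sixteen constant and sixteen rotating directions are the complete alphabet of the vertex defect's summands.
[cite: GlazmanManolescu2019, Lemma 2.1 (statement, "in the form given in [Gl]") and §2.1 (σ = 5/8)]
[cite: Glazman2015WeightedSAW, Lemma 3.1 (proof, pp. 6–7: the classes of walks through a rhombus)] -/
theorem classTerm_mem_alphabet (hh : ((w.1 - 1, w.2) : Face) ∉ D) (ω : ΩG D (w.side .W) r)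
    (hr : RootedFace D (w.side .W) r) (h : ω.IsB2a) (h0 : 0 < ω.2.firstHitG) (θ : ℝ)
    (hW : ω.WE (fun _ => θ) ≠ excursionWinding θ ω.2.firstSideG (ω.z1 hr h) ω.1) :
    ∃ j : ℤ, ω.classTerm (fun _ => θ) hr =
        (weightV θ : ℂ) * (ω.2.extWeight (fun _ => θ) r : ℂ) * Complex.exp ((((π * j / 8 : ℝ)) : ℂ) * Complex.I) ∨
      ω.classTerm (fun _ => θ) hr =
        (weightV θ : ℂ) * (ω.2.extWeight (fun _ => θ) r : ℂ) *
          Complex.exp ((((3 * θ / 8 + π * j / 8 : ℝ)) : ℂ) * Complex.I) := by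
  obtain ⟨k, hk⟩ := ω.classTerm_universal_form hh hr h h0 θ hW
  obtain ⟨hz01, hz02, hz12⟩ := ω.firstSide_exit_return_distinct hr h
  obtain ⟨m, hm | hm⟩ := dirZero_mem_alphabet θ hz01 hz02 hz12
  · refine ⟨m - 10 * k, Or.inl ?_⟩
    rw [hk, hm, phase_two_pi_mul_int, mul_assoc, cexp_mul_cexpU]
    congr 2; push_cast; ring
  · refine ⟨m - 10 * k, Or.inr ?_⟩
    rw [hk, hm, phase_two_pi_mul_int, mul_assoc, cexp_mul_cexpU]
    congr 2; push_cast; ring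

end ΩG

end Literature.Probability.RandomPlanarGeometry.SAW.YangBaxter

namespace Literature.Probability.RandomPlanarGeometry.SAW.YangBaxter

open Real Complex

/-! ## (edition 3) The universal cell law: wound mass × table direction × eighth root of unity, at every cell -/

namespace ΩG

variable {D : Set Face} {w r : Face}

open Classical in
/-- Tool notion: **the table direction of a walk** — `dir₀` of its pattern `(z₀, z₁, z₂)` if it is of class `B2a`, else `0`.
[cite: Glazman2015WeightedSAW, Lemma 3.1 (proof, pp. 6–7: the classes of walks through a rhombus)] -/
noncomputable def dirAt (θ : ℝ) (hr : RootedFace D (w.side .W) r) (ω : ΩG D (w.side .W) r) : ℂ :=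
  if h : ω.IsB2a then dirZero θ ω.2.firstSideG (ω.z1 hr h) ω.1 else 0

open Classical in
/-- Tool notion: **the sector of a walk** — for a WOUND class-`B2a` walk with non-empty prefix at a cell of a `W`-normalised
hole root, an integer `k` with `classTerm = v·ext·dir₀·phase(2πk)` (chosen by `classTerm_universal_form`); junk `0` otherwise.
[cite: GlazmanManolescu2019, §2.1, eq. (2.1) (wind(γ)) and Lemma 2.1] -/
noncomputable def sectorOf (hh : ((w.1 - 1, w.2) : Face) ∉ D) (θ : ℝ) (hr : RootedFace D (w.side .W) r)
    (ω : ΩG D (w.side .W) r) : ℤ :=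
  if h : ω.IsB2a then
    if h0 : 0 < ω.2.firstHitG then
      if hW : ω.WE (fun _ => θ) ≠ excursionWinding θ ω.2.firstSideG (ω.z1 hr h) ω.1 then
        Classical.choose (ω.classTerm_universal_form hh hr h h0 θ hW)
      else 0
    else 0
  else 0

/-- ★★ **The class term of a wound walk through the tool notions**: `classTerm = v·ext·dirAt·phase(2π·sectorOf)`.
[cite: GlazmanManolescu2019, Lemma 2.1 (statement, "in the form given in [Gl]")] [cite: Glazman2015WeightedSAW, Lemma 3.1 (proof, pp. 6–7)] -/
theorem classTerm_eq_dirAt_mul_phase_sectorOf (hh : ((w.1 - 1, w.2) : Face) ∉ D) (ω : ΩG D (w.side .W) r)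
    (hr : RootedFace D (w.side .W) r) (h : ω.IsB2a) (h0 : 0 < ω.2.firstHitG) (θ : ℝ)
    (hW : ω.WE (fun _ => θ) ≠ excursionWinding θ ω.2.firstSideG (ω.z1 hr h) ω.1) :
    ω.classTerm (fun _ => θ) hr =
      (weightV θ : ℂ) * (ω.2.extWeight (fun _ => θ) r : ℂ) * dirAt θ hr ω * phase (2 * π * sectorOf hh θ hr ω) := by
  have hspec := Classical.choose_spec (ω.classTerm_universal_form hh hr h h0 θ hW)
  rw [sectorOf, dif_pos h, dif_pos h0, dif_pos hW, dirAt, dif_pos h]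
  exact hspec

/-- ★★ **Every class term is `v · woundMassAt · dirAt · phase(2π·sectorOf)`** (class-`B2a` walks with non-empty prefix;
an unwound walk has wound mass `0` and class term `0`). [cite: GlazmanManolescu2019, Lemma 2.1 (statement, "in the form given in [Gl]")]
[cite: Glazman2015WeightedSAW, Lemma 3.1 (proof, pp. 6–7)] -/
theorem classTerm_eq_woundMassAt_mul (hh : ((w.1 - 1, w.2) : Face) ∉ D) (ω : ΩG D (w.side .W) r)
    (hr : RootedFace D (w.side .W) r) (h : ω.IsB2a) (h0 : 0 < ω.2.firstHitG) (θ : ℝ) :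
    ω.classTerm (fun _ => θ) hr =
      (weightV θ : ℂ) * (woundMassAt θ hr ω : ℂ) * dirAt θ hr ω * phase (2 * π * sectorOf hh θ hr ω) := by
  by_cases hW : ω.WE (fun _ => θ) ≠ excursionWinding θ ω.2.firstSideG (ω.z1 hr h) ω.1
  · rw [ω.classTerm_eq_dirAt_mul_phase_sectorOf hh hr h h0 θ hW, woundMassAt, dif_pos h, if_pos hW]
  · rcases ω.classTerm_dichotomy hr h θ with ⟨-, h0'⟩ | ⟨hW', -⟩
    · rw [h0', woundMassAt, dif_pos h, if_neg hW]; simp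
    · exact absurd hW' hW

/-- The prefix of a class-`B2a` walk at a cell not containing the root is not empty (twin of the ring file's private lemma).
[cite: Glazman2015WeightedSAW, Lemma 3.1 (proof, pp. 6–7); lane plumbing] -/
private theorem firstHitG_pos_of_sides_ne {c : Face} (hc : ∀ t, c.side t ≠ w.side .W) (ω : ΩG D (w.side .W) c) :
    0 < ω.2.firstHitG := by
  by_contra h0
  push Not at h0
  have e := ω.2.nth_firstHitG
  rw [Nat.le_zero.1 h0, ω.2.nth_zero] at e
  exact hc _ e.symm

variable [Finite D]

/-- ★★★ **The grouped sum at any cell**: `Σ_{B2a} classTerm = v·Σ_{B2a} woundMassAt·dirAt·phase(2π·sectorOf)` (cell not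
containing the root). [cite: GlazmanManolescu2019, Lemma 2.1 (statement, "in the form given in [Gl]")] [cite: Glazman2015WeightedSAW, Lemma 3.1 (proof, pp. 6–7)] -/
theorem sum_classTerm_eq_universal (hh : ((w.1 - 1, w.2) : Face) ∉ D) {c : Face} (hc : ∀ t, c.side t ≠ w.side .W)
    {θ : ℝ} (hr : RootedFace D (w.side .W) c) :
    ∑ ω ∈ setB2a D (w.side .W) c, ω.classTerm (fun _ => θ) hr =
      (weightV θ : ℂ) * ∑ ω ∈ setB2a D (w.side .W) c,
        (woundMassAt θ hr ω : ℂ) * dirAt θ hr ω * phase (2 * π * sectorOf hh θ hr ω) := by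
  rw [Finset.mul_sum]
  refine Finset.sum_congr rfl fun ω hω => ?_
  simp only [setB2a, Finset.mem_filter, Finset.mem_univ, true_and] at hω
  rw [ω.classTerm_eq_woundMassAt_mul hh hr hω (firstHitG_pos_of_sides_ne hc ω) θ]
  ring

end ΩG

/-- On the OPEN range every local weight of a walk is positive (private twin, to keep this leaf light).
[cite: GlazmanManolescu2019, §1, eq. (1) and Fig. 1] -/
private theorem localWeight_kindsIn_posU {θ : ℝ} (hθ : θ ∈ Set.Ioo (π / 3) (2 * π / 3)) {D : Set Face}
    {a z : MidEdge} (γ : YBWalk D a z) (f : Face) : 0 < localWeight θ (γ.kindsIn f) := by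
  have hθ' : θ ∈ Set.Ioo 0 π := ⟨by linarith [hθ.1, Real.pi_pos], by linarith [hθ.2, Real.pi_pos]⟩
  have e : γ.kindsIn f = Literature.Barriers.CriticalPhenomena.PlaquetteWalk.kindsL γ.mids f := rfl
  rw [e]
  rcases Literature.Barriers.CriticalPhenomena.PlaquetteWalk.kindsL_shape γ f with h | h | h | h | h | h <;> rw [h] <;>
    simp only [localWeight]
  · exact one_pos
  · exact weightU1_pos_of_mem_Ioo hθ'
  · exact weightU2_pos_of_mem_Ioo hθ'
  · exact weightV_pos_of_mem_Ioo hθ'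
  · rw [weightW1_eq_weightU1_mul]
    refine mul_pos (weightU1_pos_of_mem_Ioo hθ') (sub_pos.2 ?_)
    rw [← Real.sin_pi_div_two_sub]
    exact Real.sin_lt_sin_of_lt_of_le_pi_div_two (by linarith [hθ.1, Real.pi_pos]) (by linarith [hθ.1, Real.pi_pos])
      (by linarith [hθ.2])
  · rw [weightW2_eq_sqrt_two_mul]
    refine mul_pos (mul_pos (Real.sqrt_pos.2 (by norm_num)) (weightU2_pos_of_mem_Ioo hθ')) ?_
    exact Real.sin_pos_of_pos_of_lt_pi (by linarith [hθ.1]) (by linarith [hθ.2, Real.pi_pos])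

end Literature.Probability.RandomPlanarGeometry.SAW.YangBaxter

namespace Literature.Barriers.CriticalPhenomena.PlaquetteWalk

open Literature.Probability.RandomPlanarGeometry.SAW.YangBaxter
open Real Complex

/-- ★★★★ **THE UNIVERSAL CELL LAW.** For every `θ ∈ [π/3, 2π/3]`, every finite face list `Dl`, every plaquette `w` whose
`W`-neighbour `(w.1 − 1, w.2)` (the hole) is not in the domain, and every cell `c ∈ Dl` none of whose sides is the root
`w.side W`: `VF_D(w.side W, c) = i·v(θ)·Σ_{ω ∈ B2a(c)} woundMassAt(ω)·dirAt(ω)·phase(2π·sectorOf(ω))` — the vertex defect at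
ANY cell is `i·v(θ)` times a sum of wound masses along table directions `dir₀(pattern)` turned by eighth roots of unity
`ζ^{sector}`, `ζ = e^{−i5π/4}`. [cite: GlazmanManolescu2019, Lemma 2.1 (statement, "in the form given in [Gl]") and §2.1 (σ = 5/8)]
[cite: Glazman2015WeightedSAW, Lemma 3.1 (proof, pp. 6–7: the classes of walks through a rhombus)] -/
theorem vertexFunctional_printed_cell_eq_universal {θ : ℝ} (hθ : θ ∈ Set.Icc (π / 3) (2 * π / 3))
    (Dl : List Face) (w c : Face) (hf : c ∈ Dl) (hh : ((w.1 - 1, w.2) : Face) ∉ dom Dl)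
    (hc : ∀ t, c.side t ≠ w.side .W) (hr : RootedFace (dom Dl) (w.side .W) c) :
    vertexFunctional (printedWeights θ) tFiveEighths (ybCoeff θ) Dl (w.side .W) c =
      Complex.I * (weightV θ : ℂ) * ∑ ω ∈ ΩG.setB2a (dom Dl) (w.side .W) c,
        (ΩG.woundMassAt θ hr ω : ℂ) * ΩG.dirAt θ hr ω * phase (2 * π * ΩG.sectorOf hh θ hr ω) := by
  have _ := hf
  rw [vertexFunctional_printed_eq_phase_mul_lem21Defect, ← ΩG.sum_g_eq_lem21Defect,
    ΩG.sum_g_eq_I_mul_sum_classTerm (fun _ => θ) hr (fun _ => hθ), ΩG.sum_classTerm_eq_universal hh hc hr, slantPot_sideW]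
  have e0 : Complex.exp (((-(5 / 8 * (0 : ℝ)) : ℝ) : ℂ) * Complex.I) = 1 := by simp
  rw [e0, one_mul, mul_assoc]

/-- ★★★ **THE UNIVERSAL CONE LAW** (the common form of every cone law of the lane, at any cell). On `θ ∈ (π/3, 2π/3)`:
if a rotation `ρ` puts the direction `dirAt(ω)·phase(2π·sectorOf(ω))` of EVERY wound class-`B2a` walk at `c` into the open
right half-plane, and one wound walk exists, then `VF_D(w.side W, c) ≠ 0`.
[cite: GlazmanManolescu2019, Lemma 2.1 (statement, "in the form given in [Gl]")] [cite: Glazman2015WeightedSAW, Lemma 3.1 (proof, pp. 6–7)] -/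
theorem vertexFunctional_printed_cell_ne_zero_of_cone {θ : ℝ} (hθ : θ ∈ Set.Ioo (π / 3) (2 * π / 3))
    (Dl : List Face) (w c : Face) (hf : c ∈ Dl) (hh : ((w.1 - 1, w.2) : Face) ∉ dom Dl)
    (hc : ∀ t, c.side t ≠ w.side .W) (hr : RootedFace (dom Dl) (w.side .W) c) (ρ : ℂ)
    (hcone : ∀ (ω : ΩG (dom Dl) (w.side .W) c) (h : ω.IsB2a),
      ω.WE (fun _ => θ) ≠ excursionWinding θ ω.2.firstSideG (ω.z1 hr h) ω.1 →
        0 < (ρ * (ΩG.dirAt θ hr ω * phase (2 * π * ΩG.sectorOf hh θ hr ω))).re)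
    (hex : ∃ (ω : ΩG (dom Dl) (w.side .W) c) (h : ω.IsB2a),
      ω.WE (fun _ => θ) ≠ excursionWinding θ ω.2.firstSideG (ω.z1 hr h) ω.1) :
    vertexFunctional (printedWeights θ) tFiveEighths (ybCoeff θ) Dl (w.side .W) c ≠ 0 := by
  classical
  have hθ' := Set.Ioo_subset_Icc_self hθ
  have hv : (weightV θ : ℂ) ≠ 0 := by
    have hθ0 : θ ∈ Set.Ioo 0 π := ⟨by linarith [hθ.1, Real.pi_pos], by linarith [hθ.2, Real.pi_pos]⟩
    exact_mod_cast (weightV_pos_of_mem_Ioo hθ0).ne'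
  rw [vertexFunctional_printed_cell_eq_universal hθ' Dl w c hf hh hc hr]
  refine mul_ne_zero (mul_ne_zero Complex.I_ne_zero hv) fun h0 => ?_
  -- the real part of ρ·Σ is positive
  have hterm : ∀ ω ∈ ΩG.setB2a (dom Dl) (w.side .W) c,
      0 ≤ (ρ * ((ΩG.woundMassAt θ hr ω : ℂ) * ΩG.dirAt θ hr ω * phase (2 * π * ΩG.sectorOf hh θ hr ω))).re := by
    intro ω hω
    simp only [ΩG.setB2a, Finset.mem_filter, Finset.mem_univ, true_and] at hω
    have hB : ω.IsB2a := hω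
    by_cases hW : ω.WE (fun _ => θ) ≠ excursionWinding θ ω.2.firstSideG (ω.z1 hr hB) ω.1
    · have e : ρ * ((ΩG.woundMassAt θ hr ω : ℂ) * ΩG.dirAt θ hr ω * phase (2 * π * ΩG.sectorOf hh θ hr ω)) =
          (ΩG.woundMassAt θ hr ω : ℂ) * (ρ * (ΩG.dirAt θ hr ω * phase (2 * π * ΩG.sectorOf hh θ hr ω))) := by ring
      rw [e, Complex.re_ofReal_mul]
      exact mul_nonneg (ΩG.woundMassAt_nonneg hθ' hr ω) (hcone ω hB hW).le
    · rw [ΩG.woundMassAt, dif_pos hB, if_neg hW]; simp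
  obtain ⟨ω₀, h₀, hW₀⟩ := hex
  have hmem : ω₀ ∈ ΩG.setB2a (dom Dl) (w.side .W) c := by
    simp only [ΩG.setB2a, Finset.mem_filter, Finset.mem_univ, true_and]; exact h₀
  have hpos0 : 0 < (ρ * ((ΩG.woundMassAt θ hr ω₀ : ℂ) * ΩG.dirAt θ hr ω₀ * phase (2 * π * ΩG.sectorOf hh θ hr ω₀))).re := by
    have e : ρ * ((ΩG.woundMassAt θ hr ω₀ : ℂ) * ΩG.dirAt θ hr ω₀ * phase (2 * π * ΩG.sectorOf hh θ hr ω₀)) =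
        (ΩG.woundMassAt θ hr ω₀ : ℂ) * (ρ * (ΩG.dirAt θ hr ω₀ * phase (2 * π * ΩG.sectorOf hh θ hr ω₀))) := by ring
    have hext : 0 < ω₀.2.extWeight (fun _ => θ) c := Finset.prod_pos fun g _ => localWeight_kindsIn_posU hθ ω₀.2 g
    rw [e, Complex.re_ofReal_mul, ΩG.woundMassAt, dif_pos h₀, if_pos hW₀]
    exact mul_pos hext (hcone ω₀ h₀ hW₀)
  have hsum : 0 < (ρ * ∑ ω ∈ ΩG.setB2a (dom Dl) (w.side .W) c,
      (ΩG.woundMassAt θ hr ω : ℂ) * ΩG.dirAt θ hr ω * phase (2 * π * ΩG.sectorOf hh θ hr ω)).re := by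
    rw [Finset.mul_sum, Complex.re_sum]
    exact lt_of_lt_of_le hpos0 (Finset.single_le_sum hterm hmem)
  rw [h0, mul_zero, Complex.zero_re] at hsum
  exact lt_irrefl _ hsum

/-- ★★★ **THE ALIGNED LAW** (no cancellation within one direction): if every wound class-`B2a` walk at `c` has the SAME
direction `u` (`dirAt·phase(2π·sectorOf) = u`), then `VF_D(w.side W, c) = i·v(θ)·u·Σ_{B2a} woundMassAt`, `θ ∈ [π/3, 2π/3]`.
[cite: GlazmanManolescu2019, Lemma 2.1 (statement, "in the form given in [Gl]")] [cite: Glazman2015WeightedSAW, Lemma 3.1 (proof, pp. 6–7)] -/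
theorem vertexFunctional_printed_cell_eq_of_aligned {θ : ℝ} (hθ : θ ∈ Set.Icc (π / 3) (2 * π / 3))
    (Dl : List Face) (w c : Face) (hf : c ∈ Dl) (hh : ((w.1 - 1, w.2) : Face) ∉ dom Dl)
    (hc : ∀ t, c.side t ≠ w.side .W) (hr : RootedFace (dom Dl) (w.side .W) c) (u : ℂ)
    (hal : ∀ (ω : ΩG (dom Dl) (w.side .W) c) (h : ω.IsB2a),
      ω.WE (fun _ => θ) ≠ excursionWinding θ ω.2.firstSideG (ω.z1 hr h) ω.1 →
        ΩG.dirAt θ hr ω * phase (2 * π * ΩG.sectorOf hh θ hr ω) = u) :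
    vertexFunctional (printedWeights θ) tFiveEighths (ybCoeff θ) Dl (w.side .W) c =
      Complex.I * (weightV θ : ℂ) * u * ∑ ω ∈ ΩG.setB2a (dom Dl) (w.side .W) c, (ΩG.woundMassAt θ hr ω : ℂ) := by
  classical
  rw [vertexFunctional_printed_cell_eq_universal hθ Dl w c hf hh hc hr]
  have key : ∑ ω ∈ ΩG.setB2a (dom Dl) (w.side .W) c,
      (ΩG.woundMassAt θ hr ω : ℂ) * ΩG.dirAt θ hr ω * phase (2 * π * ΩG.sectorOf hh θ hr ω) =
      u * ∑ ω ∈ ΩG.setB2a (dom Dl) (w.side .W) c, (ΩG.woundMassAt θ hr ω : ℂ) := by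
    rw [Finset.mul_sum]
    refine Finset.sum_congr rfl fun ω hω => ?_
    simp only [ΩG.setB2a, Finset.mem_filter, Finset.mem_univ, true_and] at hω
    have hB : ω.IsB2a := hω
    by_cases hW : ω.WE (fun _ => θ) ≠ excursionWinding θ ω.2.firstSideG (ω.z1 hr hB) ω.1
    · rw [mul_assoc, hal ω hB hW, mul_comm]
    · rw [ΩG.woundMassAt, dif_pos hB, if_neg hW]; simp
  rw [key]; ring

/-- ★★★ **THE ALIGNED LAW, non-vanishing half**: under alignment along a unit direction (`u ≠ 0`), on `θ ∈ (π/3, 2π/3)`,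
`VF_D(w.side W, c) ≠ 0` as soon as one wound class-`B2a` walk exists at `c` — the sufficient half of the lane's encircling
criterion at any cell where the wound walks do not disperse over directions.
[cite: GlazmanManolescu2019, Lemma 2.1 (statement, "in the form given in [Gl]")] [cite: Glazman2015WeightedSAW, Lemma 3.1 (proof, pp. 6–7)] -/
theorem vertexFunctional_printed_cell_ne_zero_of_aligned {θ : ℝ} (hθ : θ ∈ Set.Ioo (π / 3) (2 * π / 3))
    (Dl : List Face) (w c : Face) (hf : c ∈ Dl) (hh : ((w.1 - 1, w.2) : Face) ∉ dom Dl)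
    (hc : ∀ t, c.side t ≠ w.side .W) (hr : RootedFace (dom Dl) (w.side .W) c) {u : ℂ} (hu : u ≠ 0)
    (hal : ∀ (ω : ΩG (dom Dl) (w.side .W) c) (h : ω.IsB2a),
      ω.WE (fun _ => θ) ≠ excursionWinding θ ω.2.firstSideG (ω.z1 hr h) ω.1 →
        ΩG.dirAt θ hr ω * phase (2 * π * ΩG.sectorOf hh θ hr ω) = u)
    (hex : ∃ (ω : ΩG (dom Dl) (w.side .W) c) (h : ω.IsB2a),
      ω.WE (fun _ => θ) ≠ excursionWinding θ ω.2.firstSideG (ω.z1 hr h) ω.1) :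
    vertexFunctional (printedWeights θ) tFiveEighths (ybCoeff θ) Dl (w.side .W) c ≠ 0 := by
  refine vertexFunctional_printed_cell_ne_zero_of_cone hθ Dl w c hf hh hc hr ((starRingEnd ℂ) u) (fun ω h hW => ?_) hex
  rw [hal ω h hW, ← Complex.normSq_eq_conj_mul_self, Complex.ofReal_re]
  exact Complex.normSq_pos.2 hu

end Literature.Barriers.CriticalPhenomena.PlaquetteWalk

end
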